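import Literature.Analysis.ValidatedNumerics.TaylorModelTrivariate
import Literature.Analysis.ValidatedNumerics.TaylorModelIntegralCert2DElem
import Mathlib.MeasureTheory.Integral.Prod
import HarnessLib

/-!
# Kernel-checkable certificates for triple integrals over boxes (Taylor-model quadrature in three variables)

Trunk T-ANA (Analysis/ValidatedNumerics); namespace `Literature.Analysis.ValidatedNumerics.PolyMP`.
Sequel of `TaylorModelTrivariate.lean` (trivariate Taylor models `TMem3 S h k l f P`, their arithmetic, the
range bound `tabs3` and the intrinsics `exp`, `1/·`, `√`, `log` with acceptance flags) and of
`TaylorModelIntegralCert2D(Elem).lean` (the same programme for double integrals: exact integration of rational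
rows `integ2Q`, the box estimate, grid and box-split certificates, the parameters `EPrm`, `panelCentreFrom`).
Berz–Makino's verified quadrature is HIGH-DIMENSIONAL by design — the integrand is modelled by a multivariate
Taylor model over each box of a partition of the domain, the polynomial part is integrated exactly and the
remainder bound is multiplied by the volume of the box (Berz–Makino 1999; Makino–Berz 2003, Algorithm 2:
`∫_D f ⊂ ∫_D P + |D| · I`) — and this file is the case of dimension three:

* **exact triple integrals of rational rows**: `integRows3` (the innermost variable integrated row-wise by
  `integRowQ`), `integ3Q p h k l = integ2Q (integRows3 p l) h k`, `integral_evalR3_ratRows3`,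
  `integral3_evalR3_ratRows3` (step 3 of op. cit. Algorithm 2);
* **the box estimate** `abs_integral3_sub_integ3Q_le`: if `P` encloses a jointly measurable `f` on
  `|ρ| ≤ h, |σ| ≤ k, |τ| ≤ l` then `|∫∫∫ f − integ3Q p h k l| ≤ (tabs3 (P − p)/S) · 2l · 2k · 2h`, together with
  the interval-integrability of the iterated integrals and of all sections (measurability of the parametric
  inner integrals by Fubini–Tonelli, Mathlib `StronglyMeasurable.integral_prod_right`; boundedness from the
  model) — step 4 of op. cit. Algorithm 2;
* **Part A — the certificate, generic in the box modeller** `Φ : ℚ → ℚ → ℚ → IPoly3 × Bool`: the box rule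
  `boxEnclG3` (exact integral of the midpoint rows widened by `⌈B · 8hkl⌉`), its soundness shape `BoxSound3`,
  the summation layers `stackEnclB3` (boxes along `z`), `stripEnclB3` (stacks along `y`), `gridEnclB3` (strips
  along `x`) proved sound ONCE by additivity of the interval integral on every section, and the one-shot
  certificate `certCheck3G` / `integral_bounds_of_certCheck3G`;
* **Part A′ — box-split certificates** (one kernel obligation per box, the lesson of the bivariate file: the
  cost of one `decide` grows faster than the number of boxes): claims `Jsss : List (List (List MI))`,
  `boxClaimG3`, `boxCheckG3 … i j p`, `sumCheckG3`, `integral_bounds_of_boxCheckG3`;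
* **Part B — the expression language `BExpr3`** (`const`, `varX`, `varY`, `varZ`, `neg`, `add`, `sub`, `mul`,
  `exp`, `log`, `inv`, `sqrt`) with `toFun₃`, joint measurability, the box model `BExpr3.model S h k l P cx cy cz`
  (`P : EPrm`) and `tmem3_model`; `certCheck3E` / `integral_bounds_of_certCheck3E` and the split
  `boxCheck3E` / `sumCheck3E` / `integral_bounds_of_boxCheck3E`, all with the conclusion
  `lo ≤ ∫_{ax}^{ax+2nh} ∫_{ay}^{ay+2mk} ∫_{az}^{az+2ol} E(x, y, z) dz dy dx ≤ hi` and NO side hypotheses.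

Deliberately NOT here: trigonometric nodes, non-box domains (graph-shaped limits as in the bivariate file would
transfer verbatim), adaptive grids, dimension `≥ 4`, singular integrands.  Cost note: a box of total degree `D`
carries `(D+1)(D+2)(D+3)/6` coefficients and an `n × m × o` grid has `nmo` boxes — certificates in three variables
should use few boxes of moderate degree and ALWAYS the split form for more than a handful of boxes.
Problem-independent; no facts, no axioms; all certificate data computable over `ℤ`.

## References

* K. Makino, M. Berz, *Taylor models and other validated functional inclusion methods*, Int. J. Pure Appl.
  Math. 4 (2003) 379–456: Algorithm 2 (Quadrature with Taylor Models over a multidimensional box: identity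
  models, code list in Taylor-model arithmetic, exact integration of the polynomial part,
  `∫_D f ⊂ ∫_D P + |D| · I`), Definition 1 (multivariate Taylor models). [cite: MakinoBerz2003, Algorithm 2]
  [cite: MakinoBerz2003, Definition 1]
* M. Berz, K. Makino, *New methods for high-dimensional verified quadrature*, Reliable Computing 5 (1999)
  13–22, Sect. 2 (multidimensional Taylor-model quadrature over boxes, remainder times volume).
  [cite: BerzMakino1999, Sect. 2]
* A. Mahboubi, G. Melquiond, T. Sibut-Pinote, *Formally verified approximations of definite integrals*, ITP 2016,
  LNCS 9807, 274–289: Sect. 3.2 Lemma 3 (polynomial enclosure of the integral), Sect. 3.3 (decomposition of the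
  domain; enclosures checked by computation). [cite: MahboubiMelquiondSibutpinote2016, Sect. 3.2 Lemma 3]
  [cite: MahboubiMelquiondSibutpinote2016, Sect. 3.3]
* Measurability of parametric integrals (Fubini–Tonelli; Mathlib `MeasureTheory.StronglyMeasurable.integral_prod_right`)
  and the translation of an interval integral (Mathlib `intervalIntegral.integral_comp_add_left`). [folklore]
-/

open MeasureTheory intervalIntegral Set
open scoped Interval

namespace Literature.Analysis.ValidatedNumerics

namespace PolyMP

open Literature.Analysis.ValidatedNumerics.NumericsMP
open Literature.Analysis.ValidatedNumerics.ExpPoly (Poly)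
open Literature.Analysis.ValidatedNumerics.ExpPoly

/-! ### Exact triple integrals of rational coefficient rows -/

/-- The innermost variable integrated: every bivariate row `q` (rows in `σ`, rational polynomials in `τ`) is
replaced by the rational polynomial in `σ` of the values `∫_{-l}^{l} q_j(τ) dτ`. [cite: MakinoBerz2003, Algorithm 2] -/
def integRows3 (p : List (List Poly)) (l : ℚ) : List Poly := p.map fun q => q.map fun r => integRowQ r l

/-- [cite: MakinoBerz2003, Algorithm 2] -/
@[simp] theorem integRows3_nil (l : ℚ) : integRows3 [] l = [] := rfl

/-- [cite: MakinoBerz2003, Algorithm 2] -/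
@[simp] theorem integRows3_cons (q : List Poly) (qs : List (List Poly)) (l : ℚ) :
    integRows3 (q :: qs) l = (q.map fun r => integRowQ r l) :: integRows3 qs l := rfl

/-- `∫_{-h}^{h} ∫_{-k}^{k} ∫_{-l}^{l} Σᵢ ρⁱ pᵢ(σ, τ) dτ dσ dρ` as an exact rational: the innermost variable row-wise,
then the bivariate `integ2Q` (step 3 of op. cit. Algorithm 2). [cite: MakinoBerz2003, Algorithm 2] -/
def integ3Q (p : List (List Poly)) (h k l : ℚ) : ℚ := integ2Q (integRows3 p l) h k

/-- The real rows of a list of rational bivariate rows. [cite: MakinoBerz2003, Algorithm 2] -/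
noncomputable def ratRows3 (p : List (List Poly)) : List (List (List ℝ)) := p.map ratRows

/-- [cite: MakinoBerz2003, Algorithm 2] -/
@[simp] theorem ratRows3_nil : ratRows3 [] = [] := rfl

/-- [cite: MakinoBerz2003, Algorithm 2] -/
@[simp] theorem ratRows3_cons (q : List Poly) (qs : List (List Poly)) :
    ratRows3 (q :: qs) = ratRows q :: ratRows3 qs := rfl

/-- [folklore] -/
private theorem continuous_evalR_tv (as : List ℝ) : Continuous (evalR as) :=
  continuous_iff_continuousAt.2 fun x => (hasDerivAt_evalR as x).continuousAt

/-- [folklore] -/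
private theorem continuous_evalR2_tv : ∀ (p : List (List ℝ)) (ρ : ℝ), Continuous fun σ => evalR2 p ρ σ
  | [], _ => by simpa using continuous_const
  | r :: rs, ρ => by
      simp only [evalR2_cons]
      exact (continuous_evalR_tv r).add (continuous_const.mul (continuous_evalR2_tv rs ρ))

/-- [folklore] -/
private theorem continuous_evalR3_tv : ∀ (p : List (List (List ℝ))) (ρ σ : ℝ), Continuous fun τ => evalR3 p ρ σ τ
  | [], _, _ => by simpa using continuous_const
  | r :: rs, ρ, σ => by
      simp only [evalR3_cons]
      exact (continuous_evalR2_tv r σ).add (continuous_const.mul (continuous_evalR3_tv rs ρ σ))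

/-- **Innermost integral of rational rows**: `∫_{-l}^{l} Σᵢ ρⁱ pᵢ(σ, τ) dτ = Σᵢ ρⁱ (∫ pᵢ(σ, ·))`, a bivariate array of
rational rows evaluated at `(ρ, σ)`. [cite: MakinoBerz2003, Algorithm 2] -/
theorem integral_evalR3_ratRows3 (p : List (List Poly)) (l : ℚ) (ρ σ : ℝ) :
    ∫ τ in (-(l : ℝ))..l, evalR3 (ratRows3 p) ρ σ τ = evalR2 (ratRows (integRows3 p l)) ρ σ := by
  induction p with
  | nil => simp
  | cons q qs ih =>
      simp only [ratRows3_cons, integRows3_cons, evalR3_cons, ratRows_cons, evalR2_cons]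
      have hc1 : IntervalIntegrable (fun τ => evalR2 (ratRows q) σ τ) volume (-(l : ℝ)) l :=
        (continuous_evalR2_tv _ σ).intervalIntegrable _ _
      have hc2 : IntervalIntegrable (fun τ => ρ * evalR3 (ratRows3 qs) ρ σ τ) volume (-(l : ℝ)) l :=
        (continuous_const.mul (continuous_evalR3_tv _ ρ σ)).intervalIntegrable _ _
      rw [intervalIntegral.integral_add hc1 hc2, intervalIntegral.integral_const_mul, ih,
        integral_evalR2_ratRows q l σ, Poly.eval_eq_evalR]

/-- **Triple integral of rational rows.** [cite: MakinoBerz2003, Algorithm 2] -/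
theorem integral3_evalR3_ratRows3 (p : List (List Poly)) (h k l : ℚ) :
    ∫ ρ in (-(h : ℝ))..h, ∫ σ in (-(k : ℝ))..k, ∫ τ in (-(l : ℝ))..l, evalR3 (ratRows3 p) ρ σ τ =
      ((integ3Q p h k l : ℚ) : ℝ) := by
  simp_rw [integral_evalR3_ratRows3]
  exact integral2_evalR2_ratRows _ h k

/-- Thin trivariate model of rational rows (row-wise `ratPoly2`). [cite: MakinoBerz2003, Algorithm 2] -/
def ratPoly3 (S : ℕ) (p : List (List Poly)) : IPoly3 := p.map (ratPoly2 S)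

/-- [folklore] -/
private theorem pmem2_ratPoly2_tv (S : ℕ) : ∀ q : List Poly, PMem2 S (ratRows q) (ratPoly2 S q)
  | [] => by simpa [ratPoly2] using pmem2_nil S
  | r :: rs => by simpa [ratPoly2] using pmem2_cons (pmem_ratPoly S r) (pmem2_ratPoly2_tv S rs)

/-- [folklore] -/
private theorem pmem3_ratPoly3 (S : ℕ) : ∀ p : List (List Poly), PMem3 S (ratRows3 p) (ratPoly3 S p)
  | [] => by simpa [ratPoly3] using pmem3_nil S
  | q :: qs => by simpa [ratPoly3] using pmem3_cons (pmem2_ratPoly2_tv S q) (pmem3_ratPoly3 S qs)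

/-- Rational rows are enclosed exactly by their thin model, on any box. [cite: MakinoBerz2003, Algorithm 2] -/
theorem tmem3_ratPoly3 (S : ℕ) (h k l : ℚ) (p : List (List Poly)) :
    TMem3 S h k l (fun ρ σ τ => evalR3 (ratRows3 p) ρ σ τ) (ratPoly3 S p) :=
  fun _ _ _ _ _ _ => ⟨ratRows3 p, pmem3_ratPoly3 S p, rfl⟩

/-! ### The box estimate -/

/-- [folklore] -/
private theorem intervalIntegrable_of_abs_le_tv {g : ℝ → ℝ} (hg : Measurable g) {k : ℚ} (k0 : 0 ≤ k) {M : ℝ}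
    (hb : ∀ σ : ℝ, |σ| ≤ k → |g σ| ≤ M) : IntervalIntegrable g volume (-(k : ℝ)) k := by
  have hk : (0 : ℝ) ≤ k := by exact_mod_cast k0
  have hle : (-(k : ℝ)) ≤ k := by linarith
  rw [intervalIntegrable_iff_integrableOn_Icc_of_le hle]
  refine Measure.integrableOn_of_bounded (M := M)
    (by rw [Real.volume_Icc]; exact ENNReal.ofReal_ne_top) hg.aestronglyMeasurable ?_
  refine (ae_restrict_iff' measurableSet_Icc).2 (Filter.Eventually.of_forall fun x hx => ?_)
  rw [Real.norm_eq_abs]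
  exact hb x (abs_le.2 ⟨hx.1, hx.2⟩)

/-- [folklore] -/
private theorem abs_two_tv {k : ℚ} (k0 : 0 ≤ k) : |(k : ℝ) - -(k : ℝ)| = 2 * k := by
  have hk : (0 : ℝ) ≤ k := by exact_mod_cast k0
  rw [sub_neg_eq_add, abs_of_nonneg (by positivity)]; ring

/-- Measurability of a parametric interval integral of a jointly measurable function (Fubini–Tonelli).
[folklore] -/
private theorem measurable_intervalIntegral_tv {α : Type*} [MeasurableSpace α] {g : α → ℝ → ℝ}
    (hg : Measurable fun q : α × ℝ => g q.1 q.2) (a b : ℝ) : Measurable fun x => ∫ σ in a..b, g x σ := by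
  have hsm : StronglyMeasurable (Function.uncurry g) := hg.stronglyMeasurable
  have h1 : StronglyMeasurable fun x => ∫ σ in Set.Ioc a b, g x σ := hsm.integral_prod_right
  have h2 : StronglyMeasurable fun x => ∫ σ in Set.Ioc b a, g x σ := hsm.integral_prod_right
  simp only [intervalIntegral]
  exact h1.measurable.sub h2.measurable

/-- **The box estimate in three variables** (op. cit. Algorithm 2, step 4: `∫_D f ⊂ ∫_D P + |D| · I`).  If `P`
encloses a jointly measurable `f` on `|ρ| ≤ h, |σ| ≤ k, |τ| ≤ l`, then for every list of rational rows `p`,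
`|∫_{-h}^{h} ∫_{-k}^{k} ∫_{-l}^{l} f − integ3Q p h k l| ≤ (tabs3 S h k l (P − p) / S) · 2l · 2k · 2h`; moreover the two
iterated inner integrals and all sections are interval integrable. [cite: MakinoBerz2003, Algorithm 2]
[cite: BerzMakino1999, Sect. 2] -/
theorem abs_integral3_sub_integ3Q_le {S : ℕ} (hS : 0 < S) {h k l : ℚ} (h0 : 0 ≤ h) (k0 : 0 ≤ k) (l0 : 0 ≤ l)
    {f : ℝ → ℝ → ℝ → ℝ} (hm : Measurable fun z : ℝ × ℝ × ℝ => f z.1 z.2.1 z.2.2) {P : IPoly3}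
    (hf : TMem3 S h k l f P) (p : List (List Poly)) :
    |(∫ ρ in (-(h : ℝ))..h, ∫ σ in (-(k : ℝ))..k, ∫ τ in (-(l : ℝ))..l, f ρ σ τ) - ((integ3Q p h k l : ℚ) : ℝ)| ≤
        (tabs3 S h k l (tsub3 P (ratPoly3 S p)) : ℝ) / S * (2 * l) * (2 * k) * (2 * h) ∧
      IntervalIntegrable (fun ρ => ∫ σ in (-(k : ℝ))..k, ∫ τ in (-(l : ℝ))..l, f ρ σ τ) volume (-(h : ℝ)) h ∧
      (∀ ρ : ℝ, |ρ| ≤ h → IntervalIntegrable (fun σ => ∫ τ in (-(l : ℝ))..l, f ρ σ τ) volume (-(k : ℝ)) k) ∧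
      ∀ ρ σ : ℝ, |ρ| ≤ h → |σ| ≤ k → IntervalIntegrable (fun τ => f ρ σ τ) volume (-(l : ℝ)) l := by
  have hSr : (0 : ℝ) < S := by exact_mod_cast hS
  have hhr : (0 : ℝ) ≤ h := by exact_mod_cast h0
  have hkr : (0 : ℝ) ≤ k := by exact_mod_cast k0
  have hlr : (0 : ℝ) ≤ l := by exact_mod_cast l0
  have hhh : (-(h : ℝ)) ≤ h := by linarith
  have hkk : (-(k : ℝ)) ≤ k := by linarith
  have hll : (-(l : ℝ)) ≤ l := by linarith
  -- pointwise bounds from the models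
  have hA : ∀ ρ σ τ : ℝ, |ρ| ≤ h → |σ| ≤ k → |τ| ≤ l → |f ρ σ τ| ≤ (tabs3 S h k l P : ℝ) / S :=
    fun ρ σ τ hρ hσ hτ => by rw [le_div_iff₀ hSr]; exact abs_le_tabs3 h0 k0 l0 hf hρ hσ hτ
  have hdiff := tmem3_sub hf (tmem3_ratPoly3 S h k l p)
  have hD : ∀ ρ σ τ : ℝ, |ρ| ≤ h → |σ| ≤ k → |τ| ≤ l →
      |f ρ σ τ - evalR3 (ratRows3 p) ρ σ τ| ≤ (tabs3 S h k l (tsub3 P (ratPoly3 S p)) : ℝ) / S :=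
    fun ρ σ τ hρ hσ hτ => by rw [le_div_iff₀ hSr]; exact abs_le_tabs3 h0 k0 l0 hdiff hρ hσ hτ
  -- measurability of the sections and of the parametric inner integrals
  have hsec : ∀ ρ σ : ℝ, Measurable fun τ => f ρ σ τ := fun ρ σ =>
    hm.comp ((measurable_prodMk_left (x := ρ)).comp (measurable_prodMk_left (x := σ)))
  have hm2 : ∀ ρ : ℝ, Measurable fun q : ℝ × ℝ => f ρ q.1 q.2 := fun ρ =>
    hm.comp (measurable_prodMk_left (x := ρ))
  have hm3 : Measurable fun w : (ℝ × ℝ) × ℝ => f w.1.1 w.1.2 w.2 :=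
    hm.comp (measurable_fst.fst.prodMk (measurable_fst.snd.prodMk measurable_snd))
  have hG2 : Measurable fun q : ℝ × ℝ => ∫ τ in (-(l : ℝ))..l, f q.1 q.2 τ :=
    measurable_intervalIntegral_tv (g := fun (q : ℝ × ℝ) (τ : ℝ) => f q.1 q.2 τ) hm3 _ _
  have hG1 : ∀ ρ : ℝ, Measurable fun σ => ∫ τ in (-(l : ℝ))..l, f ρ σ τ := fun ρ =>
    measurable_intervalIntegral_tv (g := fun σ τ => f ρ σ τ) (hm2 ρ) _ _
  have hG0 : Measurable fun ρ => ∫ σ in (-(k : ℝ))..k, ∫ τ in (-(l : ℝ))..l, f ρ σ τ :=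
    measurable_intervalIntegral_tv (g := fun ρ σ => ∫ τ in (-(l : ℝ))..l, f ρ σ τ) hG2 _ _
  -- integrability of the sections and bounds of the inner integrals
  have hIτ : ∀ ρ σ : ℝ, |ρ| ≤ h → |σ| ≤ k → IntervalIntegrable (fun τ => f ρ σ τ) volume (-(l : ℝ)) l :=
    fun ρ σ hρ hσ => intervalIntegrable_of_abs_le_tv (hsec ρ σ) l0 fun τ hτ => hA ρ σ τ hρ hσ hτ
  have hB1 : ∀ ρ σ : ℝ, |ρ| ≤ h → |σ| ≤ k →
      |∫ τ in (-(l : ℝ))..l, f ρ σ τ| ≤ (tabs3 S h k l P : ℝ) / S * (2 * l) := fun ρ σ hρ hσ => by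
    have hpt : ∀ τ ∈ Ι (-(l : ℝ)) l, ‖f ρ σ τ‖ ≤ (tabs3 S h k l P : ℝ) / S := fun τ hτ => by
      rw [uIoc_of_le hll] at hτ
      rw [Real.norm_eq_abs]; exact hA ρ σ τ hρ hσ (abs_le.2 ⟨hτ.1.le, hτ.2⟩)
    have := norm_integral_le_of_norm_le_const hpt
    rw [Real.norm_eq_abs, abs_two_tv l0] at this
    exact this
  have hIσ : ∀ ρ : ℝ, |ρ| ≤ h →
      IntervalIntegrable (fun σ => ∫ τ in (-(l : ℝ))..l, f ρ σ τ) volume (-(k : ℝ)) k := fun ρ hρ =>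
    intervalIntegrable_of_abs_le_tv (hG1 ρ) k0 fun σ hσ => hB1 ρ σ hρ hσ
  have hB2 : ∀ ρ : ℝ, |ρ| ≤ h → |∫ σ in (-(k : ℝ))..k, ∫ τ in (-(l : ℝ))..l, f ρ σ τ| ≤
      (tabs3 S h k l P : ℝ) / S * (2 * l) * (2 * k) := fun ρ hρ => by
    have hpt : ∀ σ ∈ Ι (-(k : ℝ)) k, ‖∫ τ in (-(l : ℝ))..l, f ρ σ τ‖ ≤ (tabs3 S h k l P : ℝ) / S * (2 * l) :=
      fun σ hσ => by
      rw [uIoc_of_le hkk] at hσ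
      rw [Real.norm_eq_abs]; exact hB1 ρ σ hρ (abs_le.2 ⟨hσ.1.le, hσ.2⟩)
    have := norm_integral_le_of_norm_le_const hpt
    rw [Real.norm_eq_abs, abs_two_tv k0] at this
    exact this
  have hIρ : IntervalIntegrable (fun ρ => ∫ σ in (-(k : ℝ))..k, ∫ τ in (-(l : ℝ))..l, f ρ σ τ)
      volume (-(h : ℝ)) h := intervalIntegrable_of_abs_le_tv hG0 h0 fun ρ hρ => hB2 ρ hρ
  refine ⟨?_, hIρ, hIσ, hIτ⟩
  -- the estimate: subtract the exactly integrated rational rows, bound pointwise three times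
  have hq : IntervalIntegrable (fun ρ => Poly.eval ((integRows3 p l).map fun r => integRowQ r k) ρ)
      volume (-(h : ℝ)) h := (Poly.continuous_eval _).intervalIntegrable _ _
  rw [integ3Q, integ2Q, ← integral_eval_eq_integRowQ, ← intervalIntegral.integral_sub hIρ hq]
  have hpt : ∀ ρ ∈ Ι (-(h : ℝ)) h,
      ‖(∫ σ in (-(k : ℝ))..k, ∫ τ in (-(l : ℝ))..l, f ρ σ τ) -
          Poly.eval ((integRows3 p l).map fun r => integRowQ r k) ρ‖ ≤
        (tabs3 S h k l (tsub3 P (ratPoly3 S p)) : ℝ) / S * (2 * l) * (2 * k) := by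
    intro ρ hρ'
    rw [uIoc_of_le hhh] at hρ'
    have hρ : |ρ| ≤ h := abs_le.2 ⟨hρ'.1.le, hρ'.2⟩
    rw [← integral_evalR2_ratRows (integRows3 p l) k ρ, ← intervalIntegral.integral_sub (hIσ ρ hρ)
      ((continuous_evalR2_tv _ ρ).intervalIntegrable _ _)]
    have hpt' : ∀ σ ∈ Ι (-(k : ℝ)) k,
        ‖(∫ τ in (-(l : ℝ))..l, f ρ σ τ) - evalR2 (ratRows (integRows3 p l)) ρ σ‖ ≤
          (tabs3 S h k l (tsub3 P (ratPoly3 S p)) : ℝ) / S * (2 * l) := by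
      intro σ hσ'
      rw [uIoc_of_le hkk] at hσ'
      have hσ : |σ| ≤ k := abs_le.2 ⟨hσ'.1.le, hσ'.2⟩
      rw [← integral_evalR3_ratRows3 p l ρ σ, ← intervalIntegral.integral_sub (hIτ ρ σ hρ hσ)
        ((continuous_evalR3_tv _ ρ σ).intervalIntegrable _ _)]
      have hpt'' : ∀ τ ∈ Ι (-(l : ℝ)) l, ‖f ρ σ τ - evalR3 (ratRows3 p) ρ σ τ‖ ≤
          (tabs3 S h k l (tsub3 P (ratPoly3 S p)) : ℝ) / S := fun τ hτ => by
        rw [uIoc_of_le hll] at hτ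
        rw [Real.norm_eq_abs]; exact hD ρ σ τ hρ hσ (abs_le.2 ⟨hτ.1.le, hτ.2⟩)
      have := norm_integral_le_of_norm_le_const hpt''
      rw [abs_two_tv l0] at this
      exact this
    have := norm_integral_le_of_norm_le_const hpt'
    rw [abs_two_tv k0] at this
    exact this
  have := norm_integral_le_of_norm_le_const hpt
  rw [Real.norm_eq_abs, abs_two_tv h0] at this
  exact this

/-! ### Part A. The grid certificate, generic in the box modeller -/

/-- The rational midpoint rows of a trivariate model (row-wise `midRows`; the reference polynomial integrated
exactly). [cite: MakinoBerz2003, Algorithm 2] -/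
def midRows3 (S : ℕ) (P : IPoly3) : List (List Poly) := P.map (midRows S)

/-- The scaled box error `⌈B · 8hkl⌉` (`B/S` bounds `|f − p|` on the box of volume `8hkl`). [cite: MakinoBerz2003, Algorithm 2] -/
def boxErr3 (h k l : ℚ) (B : ℤ) : ℤ := ⌈(B : ℚ) * (8 * h * k * l)⌉

/-- **One box, generic**: `Φ cx cy cz` = (box model of `(u, v, w) ↦ f(cx + u, cy + v, cz + w)` on
`|u| ≤ h, |v| ≤ k, |w| ≤ l`, flag); the enclosure is the exact integral of the midpoint rows widened by the box
error. [cite: MakinoBerz2003, Algorithm 2] -/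
def boxEnclG3 (S : ℕ) (h k l : ℚ) (Φ : ℚ → ℚ → ℚ → IPoly3 × Bool) (cx cy cz : ℚ) : MI × Bool :=
  let r := Φ cx cy cz
  let p := midRows3 S r.1
  (MI.widen (ofRat S (integ3Q p h k l)) (boxErr3 h k l (tabs3 S h k l (tsub3 r.1 (ratPoly3 S p)))), r.2)

/-- **Soundness shape of a box rule** `β : centre ↦ (enclosure, flag)` for `f` on boxes of half-widths `h, k, l`:
an accepted box encloses `∫_{-h}^{h} ∫_{-k}^{k} ∫_{-l}^{l} f(cx + u, cy + v, cz + w) dw dv du` and the iterated inner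
integrals and the sections are interval integrable. [cite: MakinoBerz2003, Algorithm 2] -/
def BoxSound3 (S : ℕ) (h k l : ℚ) (f : ℝ → ℝ → ℝ → ℝ) (β : ℚ → ℚ → ℚ → MI × Bool) : Prop :=
  ∀ cx cy cz : ℚ, (β cx cy cz).2 = true →
    MI.mem S (∫ u in (-(h : ℝ))..h, ∫ v in (-(k : ℝ))..k, ∫ w in (-(l : ℝ))..l,
        f ((cx : ℝ) + u) ((cy : ℝ) + v) ((cz : ℝ) + w)) (β cx cy cz).1 ∧
      IntervalIntegrable (fun u => ∫ v in (-(k : ℝ))..k, ∫ w in (-(l : ℝ))..l,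
        f ((cx : ℝ) + u) ((cy : ℝ) + v) ((cz : ℝ) + w)) volume (-(h : ℝ)) h ∧
      (∀ u : ℝ, |u| ≤ h → IntervalIntegrable (fun v => ∫ w in (-(l : ℝ))..l,
        f ((cx : ℝ) + u) ((cy : ℝ) + v) ((cz : ℝ) + w)) volume (-(k : ℝ)) k) ∧
      ∀ u v : ℝ, |u| ≤ h → |v| ≤ k →
        IntervalIntegrable (fun w => f ((cx : ℝ) + u) ((cy : ℝ) + v) ((cz : ℝ) + w)) volume (-(l : ℝ)) l

/-- [folklore] -/
private theorem mem_zeroMI_tv (S : ℕ) : MI.mem S 0 ⟨0, 0⟩ := by simp [MI.mem]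

/-- [folklore] -/
private theorem boxEnclG3_sound {S : ℕ} (hS : 0 < S) {h k l : ℚ} (h0 : 0 < h) (k0 : 0 < k) (l0 : 0 < l)
    {f : ℝ → ℝ → ℝ → ℝ} (hf : Measurable fun z : ℝ × ℝ × ℝ => f z.1 z.2.1 z.2.2)
    {Φ : ℚ → ℚ → ℚ → IPoly3 × Bool}
    (hΦ : ∀ cx cy cz : ℚ, (Φ cx cy cz).2 = true →
      TMem3 S h k l (fun u v w => f ((cx : ℝ) + u) ((cy : ℝ) + v) ((cz : ℝ) + w)) (Φ cx cy cz).1) :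
    BoxSound3 S h k l f (boxEnclG3 S h k l Φ) := by
  intro cx cy cz hok
  simp only [boxEnclG3] at hok ⊢
  have hT := hΦ cx cy cz hok
  have hm : Measurable fun z : ℝ × ℝ × ℝ => f ((cx : ℝ) + z.1) ((cy : ℝ) + z.2.1) ((cz : ℝ) + z.2.2) :=
    hf.comp ((measurable_const.add measurable_fst).prodMk
      ((measurable_const.add measurable_snd.fst).prodMk (measurable_const.add measurable_snd.snd)))
  obtain ⟨hest, hI, hσ, hτ⟩ :=
    abs_integral3_sub_integ3Q_le hS h0.le k0.le l0.le hm hT (midRows3 S (Φ cx cy cz).1)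
  refine ⟨MI.mem_widen (mem_ofRat S _) ?_, hI, hσ, hτ⟩
  have hSr : (0 : ℝ) < S := by exact_mod_cast hS
  set B : ℤ := tabs3 S h k l (tsub3 (Φ cx cy cz).1 (ratPoly3 S (midRows3 S (Φ cx cy cz).1))) with hB
  have h1 := mul_le_mul_of_nonneg_right hest hSr.le
  have h2 : (B : ℝ) / S * (2 * l) * (2 * k) * (2 * h) * S = (((B : ℚ) * (8 * h * k * l) : ℚ) : ℝ) := by
    push_cast; field_simp; ring
  have h3 : (((B : ℚ) * (8 * h * k * l) : ℚ) : ℝ) ≤ (boxErr3 h k l B : ℝ) := by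
    unfold boxErr3; exact_mod_cast Int.le_ceil _
  rw [h2] at h1
  exact h1.trans h3

/-- **A stack of boxes over a box rule**: centre `(cx, cy)`, `o` z-panels of half-width `l` from `z = a`; summed,
conjunctive flag. [cite: MakinoBerz2003, Algorithm 2] -/
def stackEnclB3 (l : ℚ) (β : ℚ → ℚ → ℚ → MI × Bool) (cx cy : ℚ) : ℚ → ℕ → MI × Bool
  | _, 0 => (⟨0, 0⟩, true)
  | a, o + 1 =>
      let b := β cx cy (a + l)
      let s := stackEnclB3 l β cx cy (a + 2 * l) o
      (MI.add b.1 s.1, b.2 && s.2)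

/-- [folklore] -/
private theorem stackEnclB3_sound {S : ℕ} {h k l : ℚ} (h0 : 0 < h) (k0 : 0 < k) {f : ℝ → ℝ → ℝ → ℝ}
    {β : ℚ → ℚ → ℚ → MI × Bool} (HB : BoxSound3 S h k l f β) (cx cy : ℚ) :
    ∀ (o : ℕ) (a : ℚ), (stackEnclB3 l β cx cy a o).2 = true →
      MI.mem S (∫ u in (-(h : ℝ))..h, ∫ v in (-(k : ℝ))..k, ∫ z in (a : ℝ)..((a : ℝ) + 2 * o * l),
          f ((cx : ℝ) + u) ((cy : ℝ) + v) z) (stackEnclB3 l β cx cy a o).1 ∧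
        IntervalIntegrable (fun u => ∫ v in (-(k : ℝ))..k, ∫ z in (a : ℝ)..((a : ℝ) + 2 * o * l),
          f ((cx : ℝ) + u) ((cy : ℝ) + v) z) volume (-(h : ℝ)) h ∧
        (∀ u : ℝ, |u| ≤ h → IntervalIntegrable (fun v => ∫ z in (a : ℝ)..((a : ℝ) + 2 * o * l),
          f ((cx : ℝ) + u) ((cy : ℝ) + v) z) volume (-(k : ℝ)) k) ∧
        ∀ u v : ℝ, |u| ≤ h → |v| ≤ k →
          IntervalIntegrable (fun z => f ((cx : ℝ) + u) ((cy : ℝ) + v) z) volume (a : ℝ) ((a : ℝ) + 2 * o * l)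
  | 0, a, _ => by
      simp only [Nat.cast_zero, mul_zero, zero_mul, add_zero, intervalIntegral.integral_same,
        intervalIntegral.integral_zero, stackEnclB3]
      exact ⟨mem_zeroMI_tv S, intervalIntegrable_const, fun u _ => intervalIntegrable_const,
        fun u v _ _ => IntervalIntegrable.refl⟩
  | o + 1, a, hok => by
      have hhr : (0 : ℝ) ≤ h := by exact_mod_cast h0.le
      have hhh : (-(h : ℝ)) ≤ h := by linarith
      have hkr : (0 : ℝ) ≤ k := by exact_mod_cast k0.le
      have hkk : (-(k : ℝ)) ≤ k := by linarith
      simp only [stackEnclB3, Bool.and_eq_true] at hok ⊢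
      obtain ⟨hb, hs⟩ := hok
      obtain ⟨hbm, hbI, hbσ, hbτ⟩ := HB cx cy (a + l) hb
      obtain ⟨ihm, ihI, ihσ, ihτ⟩ := stackEnclB3_sound h0 k0 HB cx cy o (a + 2 * l) hs
      have el : ((a + 2 * l : ℚ) : ℝ) = (a : ℝ) + 2 * l := by push_cast; ring
      have er : ((a + 2 * l : ℚ) : ℝ) + 2 * (o : ℝ) * l = (a : ℝ) + 2 * ((o + 1 : ℕ) : ℝ) * l := by
        push_cast; ring
      rw [er, el] at ihm ihI ihσ ihτ
      have e1 : ((a + l : ℚ) : ℝ) + -(l : ℝ) = (a : ℝ) := by push_cast; ring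
      have e2 : ((a + l : ℚ) : ℝ) + (l : ℝ) = (a : ℝ) + 2 * l := by push_cast; ring
      -- the sections of the first panel
      have hfirst : ∀ u v : ℝ, |u| ≤ h → |v| ≤ k →
          IntervalIntegrable (fun z => f ((cx : ℝ) + u) ((cy : ℝ) + v) z) volume (a : ℝ) ((a : ℝ) + 2 * l) := by
        intro u v hu hv
        have h1 := (hbτ u v hu hv).comp_sub_right ((a + l : ℚ) : ℝ)
        have e0 : (fun z => f ((cx : ℝ) + u) ((cy : ℝ) + v) (((a + l : ℚ) : ℝ) + (z - ((a + l : ℚ) : ℝ)))) =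
            fun z => f ((cx : ℝ) + u) ((cy : ℝ) + v) z := by
          funext z; simp only [add_sub_cancel]
        have ea : -(l : ℝ) + ((a + l : ℚ) : ℝ) = (a : ℝ) := by push_cast; ring
        have eb : (l : ℝ) + ((a + l : ℚ) : ℝ) = (a : ℝ) + 2 * l := by push_cast; ring
        rw [e0, ea, eb] at h1
        exact h1
      -- the first box rewritten over `z ∈ [a, a + 2l]`
      have ebox : ∀ u v : ℝ,
          (∫ w in (-(l : ℝ))..l, f ((cx : ℝ) + u) ((cy : ℝ) + v) (((a + l : ℚ) : ℝ) + w)) =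
            ∫ z in (a : ℝ)..((a : ℝ) + 2 * l), f ((cx : ℝ) + u) ((cy : ℝ) + v) z := by
        intro u v
        rw [intervalIntegral.integral_comp_add_left (fun z => f ((cx : ℝ) + u) ((cy : ℝ) + v) z)
          ((a + l : ℚ) : ℝ), e1, e2]
      simp_rw [ebox] at hbm hbI hbσ
      -- additivity in `z` on every `(u, v)` section, then of the `v`-integrals on every `u` section
      have hz : ∀ u v : ℝ, |u| ≤ h → |v| ≤ k →
          (∫ z in (a : ℝ)..((a : ℝ) + 2 * l), f ((cx : ℝ) + u) ((cy : ℝ) + v) z) +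
              ∫ z in ((a : ℝ) + 2 * l)..((a : ℝ) + 2 * ((o + 1 : ℕ) : ℝ) * l), f ((cx : ℝ) + u) ((cy : ℝ) + v) z =
            ∫ z in (a : ℝ)..((a : ℝ) + 2 * ((o + 1 : ℕ) : ℝ) * l), f ((cx : ℝ) + u) ((cy : ℝ) + v) z :=
        fun u v hu hv => intervalIntegral.integral_add_adjacent_intervals (hfirst u v hu hv) (ihτ u v hu hv)
      have hv : ∀ u : ℝ, |u| ≤ h →
          (∫ v in (-(k : ℝ))..k, ∫ z in (a : ℝ)..((a : ℝ) + 2 * l), f ((cx : ℝ) + u) ((cy : ℝ) + v) z) +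
              ∫ v in (-(k : ℝ))..k, ∫ z in ((a : ℝ) + 2 * l)..((a : ℝ) + 2 * ((o + 1 : ℕ) : ℝ) * l),
                f ((cx : ℝ) + u) ((cy : ℝ) + v) z =
            ∫ v in (-(k : ℝ))..k, ∫ z in (a : ℝ)..((a : ℝ) + 2 * ((o + 1 : ℕ) : ℝ) * l),
                f ((cx : ℝ) + u) ((cy : ℝ) + v) z := by
        intro u hu
        rw [← intervalIntegral.integral_add (hbσ u hu) (ihσ u hu)]
        refine intervalIntegral.integral_congr fun v hv' => ?_
        rw [uIcc_of_le hkk] at hv'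
        exact hz u v hu (abs_le.2 ⟨hv'.1, hv'.2⟩)
      have hIv : ∀ u : ℝ, |u| ≤ h →
          IntervalIntegrable (fun v => ∫ z in (a : ℝ)..((a : ℝ) + 2 * ((o + 1 : ℕ) : ℝ) * l),
            f ((cx : ℝ) + u) ((cy : ℝ) + v) z) volume (-(k : ℝ)) k := fun u hu =>
        ((hbσ u hu).add (ihσ u hu)).congr fun v hv' => by
          rw [uIoc_of_le hkk] at hv'
          exact hz u v hu (abs_le.2 ⟨hv'.1.le, hv'.2⟩)
      have heqOn : EqOn
          (fun u => (∫ v in (-(k : ℝ))..k, ∫ z in (a : ℝ)..((a : ℝ) + 2 * l), f ((cx : ℝ) + u) ((cy : ℝ) + v) z) +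
            ∫ v in (-(k : ℝ))..k, ∫ z in ((a : ℝ) + 2 * l)..((a : ℝ) + 2 * ((o + 1 : ℕ) : ℝ) * l),
              f ((cx : ℝ) + u) ((cy : ℝ) + v) z)
          (fun u => ∫ v in (-(k : ℝ))..k, ∫ z in (a : ℝ)..((a : ℝ) + 2 * ((o + 1 : ℕ) : ℝ) * l),
              f ((cx : ℝ) + u) ((cy : ℝ) + v) z) (uIcc (-(h : ℝ)) h) := by
        intro u hu
        rw [uIcc_of_le hhh] at hu
        exact hv u (abs_le.2 ⟨hu.1, hu.2⟩)
      refine ⟨?_, ?_, hIv, fun u v hu hv' => (hfirst u v hu hv').trans (ihτ u v hu hv')⟩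
      · rw [← intervalIntegral.integral_congr heqOn, intervalIntegral.integral_add hbI ihI]
        exact MI.mem_add hbm ihm
      · exact (hbI.add ihI).congr fun u hu => heqOn (uIoc_subset_uIcc hu)

/-- **A strip of stacks over a box rule**: x-centre `cx`, `m` y-panels of half-width `k` from `y = a`, each a stack
of `o` z-panels from `z = az`; summed, conjunctive flag. [cite: MakinoBerz2003, Algorithm 2] -/
def stripEnclB3 (k l : ℚ) (β : ℚ → ℚ → ℚ → MI × Bool) (cx az : ℚ) (o : ℕ) : ℚ → ℕ → MI × Bool
  | _, 0 => (⟨0, 0⟩, true)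
  | a, m + 1 =>
      let s := stackEnclB3 l β cx (a + k) az o
      let t := stripEnclB3 k l β cx az o (a + 2 * k) m
      (MI.add s.1 t.1, s.2 && t.2)

/-- [folklore] -/
private theorem stripEnclB3_sound {S : ℕ} {h k l : ℚ} (h0 : 0 < h) (k0 : 0 < k) {f : ℝ → ℝ → ℝ → ℝ}
    {β : ℚ → ℚ → ℚ → MI × Bool} (HB : BoxSound3 S h k l f β) (cx az : ℚ) (o : ℕ) :
    ∀ (m : ℕ) (a : ℚ), (stripEnclB3 k l β cx az o a m).2 = true →
      MI.mem S (∫ u in (-(h : ℝ))..h, ∫ y in (a : ℝ)..((a : ℝ) + 2 * m * k),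
          ∫ z in (az : ℝ)..((az : ℝ) + 2 * o * l), f ((cx : ℝ) + u) y z) (stripEnclB3 k l β cx az o a m).1 ∧
        IntervalIntegrable (fun u => ∫ y in (a : ℝ)..((a : ℝ) + 2 * m * k),
          ∫ z in (az : ℝ)..((az : ℝ) + 2 * o * l), f ((cx : ℝ) + u) y z) volume (-(h : ℝ)) h ∧
        ∀ u : ℝ, |u| ≤ h → IntervalIntegrable (fun y => ∫ z in (az : ℝ)..((az : ℝ) + 2 * o * l),
          f ((cx : ℝ) + u) y z) volume (a : ℝ) ((a : ℝ) + 2 * m * k)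
  | 0, a, _ => by
      simp only [Nat.cast_zero, mul_zero, zero_mul, add_zero, intervalIntegral.integral_same,
        intervalIntegral.integral_zero, stripEnclB3]
      exact ⟨mem_zeroMI_tv S, intervalIntegrable_const, fun u _ => IntervalIntegrable.refl⟩
  | m + 1, a, hok => by
      have hhr : (0 : ℝ) ≤ h := by exact_mod_cast h0.le
      have hhh : (-(h : ℝ)) ≤ h := by linarith
      simp only [stripEnclB3, Bool.and_eq_true] at hok ⊢
      obtain ⟨hs, ht⟩ := hok
      obtain ⟨hsm, hsI, hsσ, -⟩ := stackEnclB3_sound h0 k0 HB cx (a + k) o az hs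
      obtain ⟨ihm, ihI, ihσ⟩ := stripEnclB3_sound h0 k0 HB cx az o m (a + 2 * k) ht
      have el : ((a + 2 * k : ℚ) : ℝ) = (a : ℝ) + 2 * k := by push_cast; ring
      have er : ((a + 2 * k : ℚ) : ℝ) + 2 * (m : ℝ) * k = (a : ℝ) + 2 * ((m + 1 : ℕ) : ℝ) * k := by
        push_cast; ring
      rw [er, el] at ihm ihI ihσ
      have e1 : ((a + k : ℚ) : ℝ) + -(k : ℝ) = (a : ℝ) := by push_cast; ring
      have e2 : ((a + k : ℚ) : ℝ) + (k : ℝ) = (a : ℝ) + 2 * k := by push_cast; ring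
      -- the sections of the first panel
      have hfirst : ∀ u : ℝ, |u| ≤ h → IntervalIntegrable
          (fun y => ∫ z in (az : ℝ)..((az : ℝ) + 2 * o * l), f ((cx : ℝ) + u) y z)
          volume (a : ℝ) ((a : ℝ) + 2 * k) := by
        intro u hu
        have h1 := (hsσ u hu).comp_sub_right ((a + k : ℚ) : ℝ)
        have e0 : (fun y => ∫ z in (az : ℝ)..((az : ℝ) + 2 * o * l),
              f ((cx : ℝ) + u) (((a + k : ℚ) : ℝ) + (y - ((a + k : ℚ) : ℝ))) z) =
            fun y => ∫ z in (az : ℝ)..((az : ℝ) + 2 * o * l), f ((cx : ℝ) + u) y z := by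
          funext y; simp only [add_sub_cancel]
        have ea : -(k : ℝ) + ((a + k : ℚ) : ℝ) = (a : ℝ) := by push_cast; ring
        have eb : (k : ℝ) + ((a + k : ℚ) : ℝ) = (a : ℝ) + 2 * k := by push_cast; ring
        rw [e0, ea, eb] at h1
        exact h1
      -- the first stack rewritten over `y ∈ [a, a + 2k]`
      have estack : ∀ u : ℝ, (∫ v in (-(k : ℝ))..k, ∫ z in (az : ℝ)..((az : ℝ) + 2 * o * l),
            f ((cx : ℝ) + u) (((a + k : ℚ) : ℝ) + v) z) =
          ∫ y in (a : ℝ)..((a : ℝ) + 2 * k), ∫ z in (az : ℝ)..((az : ℝ) + 2 * o * l), f ((cx : ℝ) + u) y z := by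
        intro u
        rw [intervalIntegral.integral_comp_add_left
          (fun y => ∫ z in (az : ℝ)..((az : ℝ) + 2 * o * l), f ((cx : ℝ) + u) y z) ((a + k : ℚ) : ℝ), e1, e2]
      simp_rw [estack] at hsm hsI
      -- additivity in `y` on every `u` section
      have hy : ∀ u : ℝ, |u| ≤ h →
          (∫ y in (a : ℝ)..((a : ℝ) + 2 * k), ∫ z in (az : ℝ)..((az : ℝ) + 2 * o * l), f ((cx : ℝ) + u) y z) +
              ∫ y in ((a : ℝ) + 2 * k)..((a : ℝ) + 2 * ((m + 1 : ℕ) : ℝ) * k),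
                ∫ z in (az : ℝ)..((az : ℝ) + 2 * o * l), f ((cx : ℝ) + u) y z =
            ∫ y in (a : ℝ)..((a : ℝ) + 2 * ((m + 1 : ℕ) : ℝ) * k),
                ∫ z in (az : ℝ)..((az : ℝ) + 2 * o * l), f ((cx : ℝ) + u) y z :=
        fun u hu => intervalIntegral.integral_add_adjacent_intervals (hfirst u hu) (ihσ u hu)
      have heqOn : EqOn
          (fun u => (∫ y in (a : ℝ)..((a : ℝ) + 2 * k), ∫ z in (az : ℝ)..((az : ℝ) + 2 * o * l),
              f ((cx : ℝ) + u) y z) +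
            ∫ y in ((a : ℝ) + 2 * k)..((a : ℝ) + 2 * ((m + 1 : ℕ) : ℝ) * k),
              ∫ z in (az : ℝ)..((az : ℝ) + 2 * o * l), f ((cx : ℝ) + u) y z)
          (fun u => ∫ y in (a : ℝ)..((a : ℝ) + 2 * ((m + 1 : ℕ) : ℝ) * k),
              ∫ z in (az : ℝ)..((az : ℝ) + 2 * o * l), f ((cx : ℝ) + u) y z) (uIcc (-(h : ℝ)) h) := by
        intro u hu
        rw [uIcc_of_le hhh] at hu
        exact hy u (abs_le.2 ⟨hu.1, hu.2⟩)
      refine ⟨?_, ?_, fun u hu => (hfirst u hu).trans (ihσ u hu)⟩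
      · rw [← intervalIntegral.integral_congr heqOn, intervalIntegral.integral_add hsI ihI]
        exact MI.mem_add hsm ihm
      · exact (hsI.add ihI).congr fun u hu => heqOn (uIoc_subset_uIcc hu)

/-- **The grid over a box rule**: `n` x-panels of half-width `h` from `x = a`, each a strip of `m` y-panels from
`y = ay` of stacks of `o` z-panels from `z = az`; summed, conjunctive flag. [cite: MakinoBerz2003, Algorithm 2] -/
def gridEnclB3 (h k l : ℚ) (β : ℚ → ℚ → ℚ → MI × Bool) (ay : ℚ) (m : ℕ) (az : ℚ) (o : ℕ) : ℚ → ℕ → MI × Bool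
  | _, 0 => (⟨0, 0⟩, true)
  | a, n + 1 =>
      let s := stripEnclB3 k l β (a + h) az o ay m
      let g := gridEnclB3 h k l β ay m az o (a + 2 * h) n
      (MI.add s.1 g.1, s.2 && g.2)

/-- [folklore] -/
private theorem gridEnclB3_sound {S : ℕ} {h k l : ℚ} (h0 : 0 < h) (k0 : 0 < k) {f : ℝ → ℝ → ℝ → ℝ}
    {β : ℚ → ℚ → ℚ → MI × Bool} (HB : BoxSound3 S h k l f β) (ay : ℚ) (m : ℕ) (az : ℚ) (o : ℕ) :
    ∀ (n : ℕ) (a : ℚ), (gridEnclB3 h k l β ay m az o a n).2 = true →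
      MI.mem S (∫ x in (a : ℝ)..((a : ℝ) + 2 * n * h), ∫ y in (ay : ℝ)..((ay : ℝ) + 2 * m * k),
          ∫ z in (az : ℝ)..((az : ℝ) + 2 * o * l), f x y z) (gridEnclB3 h k l β ay m az o a n).1 ∧
        IntervalIntegrable (fun x => ∫ y in (ay : ℝ)..((ay : ℝ) + 2 * m * k),
          ∫ z in (az : ℝ)..((az : ℝ) + 2 * o * l), f x y z) volume (a : ℝ) ((a : ℝ) + 2 * n * h)
  | 0, a, _ => by
      simp only [Nat.cast_zero, mul_zero, zero_mul, add_zero, intervalIntegral.integral_same, gridEnclB3]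
      exact ⟨mem_zeroMI_tv S, IntervalIntegrable.refl⟩
  | n + 1, a, hok => by
      simp only [gridEnclB3, Bool.and_eq_true] at hok ⊢
      obtain ⟨hs, hg⟩ := hok
      obtain ⟨hsm, hsI, -⟩ := stripEnclB3_sound h0 k0 HB (a + h) az o m ay hs
      obtain ⟨ihm, ihI⟩ := gridEnclB3_sound h0 k0 HB ay m az o n (a + 2 * h) hg
      have el : ((a + 2 * h : ℚ) : ℝ) = (a : ℝ) + 2 * h := by push_cast; ring
      have er : ((a + 2 * h : ℚ) : ℝ) + 2 * (n : ℝ) * h = (a : ℝ) + 2 * ((n + 1 : ℕ) : ℝ) * h := by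
        push_cast; ring
      rw [er, el] at ihm ihI
      have e1 : ((a + h : ℚ) : ℝ) + -(h : ℝ) = (a : ℝ) := by push_cast; ring
      have e2 : ((a + h : ℚ) : ℝ) + (h : ℝ) = (a : ℝ) + 2 * h := by push_cast; ring
      have hval : ∫ u in (-(h : ℝ))..h, ∫ y in (ay : ℝ)..((ay : ℝ) + 2 * m * k),
            ∫ z in (az : ℝ)..((az : ℝ) + 2 * o * l), f (((a + h : ℚ) : ℝ) + u) y z =
          ∫ x in (a : ℝ)..((a : ℝ) + 2 * h), ∫ y in (ay : ℝ)..((ay : ℝ) + 2 * m * k),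
            ∫ z in (az : ℝ)..((az : ℝ) + 2 * o * l), f x y z := by
        rw [intervalIntegral.integral_comp_add_left
          (fun x => ∫ y in (ay : ℝ)..((ay : ℝ) + 2 * m * k), ∫ z in (az : ℝ)..((az : ℝ) + 2 * o * l), f x y z)
          ((a + h : ℚ) : ℝ), e1, e2]
      have hI1 : IntervalIntegrable (fun x => ∫ y in (ay : ℝ)..((ay : ℝ) + 2 * m * k),
          ∫ z in (az : ℝ)..((az : ℝ) + 2 * o * l), f x y z) volume (a : ℝ) ((a : ℝ) + 2 * h) := by
        have h1 := hsI.comp_sub_right ((a + h : ℚ) : ℝ)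
        have e0 : (fun x => ∫ y in (ay : ℝ)..((ay : ℝ) + 2 * m * k), ∫ z in (az : ℝ)..((az : ℝ) + 2 * o * l),
              f (((a + h : ℚ) : ℝ) + (x - ((a + h : ℚ) : ℝ))) y z) =
            fun x => ∫ y in (ay : ℝ)..((ay : ℝ) + 2 * m * k), ∫ z in (az : ℝ)..((az : ℝ) + 2 * o * l),
              f x y z := by
          funext x; simp only [add_sub_cancel]
        have ea : -(h : ℝ) + ((a + h : ℚ) : ℝ) = (a : ℝ) := by push_cast; ring
        have eb : (h : ℝ) + ((a + h : ℚ) : ℝ) = (a : ℝ) + 2 * h := by push_cast; ring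
        rw [e0, ea, eb] at h1
        exact h1
      rw [hval] at hsm
      refine ⟨?_, hI1.trans ihI⟩
      rw [← intervalIntegral.integral_add_adjacent_intervals hI1 ihI]
      exact MI.mem_add hsm ihm

/-- [folklore] -/
private theorem bounds_of_grid3 {S : ℕ} (hS : 0 < S) {h k l : ℚ} (h0 : 0 < h) (k0 : 0 < k)
    {f : ℝ → ℝ → ℝ → ℝ} {β : ℚ → ℚ → ℚ → MI × Bool} (HB : BoxSound3 S h k l f β) {ax ay az : ℚ}
    {n m o : ℕ} {lo hi : ℚ} (hok : (gridEnclB3 h k l β ay m az o ax n).2 = true)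
    (hlo : lo * S ≤ ((gridEnclB3 h k l β ay m az o ax n).1.lo : ℚ))
    (hhi : ((gridEnclB3 h k l β ay m az o ax n).1.hi : ℚ) ≤ hi * S) :
    (lo : ℝ) ≤ ∫ x in (ax : ℝ)..((ax : ℝ) + 2 * n * h), ∫ y in (ay : ℝ)..((ay : ℝ) + 2 * m * k),
        ∫ z in (az : ℝ)..((az : ℝ) + 2 * o * l), f x y z ∧
      ∫ x in (ax : ℝ)..((ax : ℝ) + 2 * n * h), ∫ y in (ay : ℝ)..((ay : ℝ) + 2 * m * k),
        ∫ z in (az : ℝ)..((az : ℝ) + 2 * o * l), f x y z ≤ (hi : ℝ) := by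
  obtain ⟨⟨h1, h2⟩, -⟩ := gridEnclB3_sound h0 k0 HB ay m az o n ax hok
  have hSr : (0 : ℝ) < S := by exact_mod_cast hS
  have hloR : (lo : ℝ) * S ≤ ((gridEnclB3 h k l β ay m az o ax n).1.lo : ℝ) := by exact_mod_cast hlo
  have hhiR : ((gridEnclB3 h k l β ay m az o ax n).1.hi : ℝ) ≤ (hi : ℝ) * S := by exact_mod_cast hhi
  exact ⟨le_of_mul_le_mul_right (hloR.trans h1) hSr, le_of_mul_le_mul_right (h2.trans hhiR) hSr⟩

/-- **The generic one-shot certificate** for `lo ≤ ∫_{ax}^{ax+2nh} ∫_{ay}^{ay+2mk} ∫_{az}^{az+2ol} f ≤ hi`: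
positivity of `S`, `h`, `k`, `l`, every box accepted, kernel enclosure inside `[lo·S, hi·S]`.
[cite: MakinoBerz2003, Algorithm 2] -/
def certCheck3G (S : ℕ) (h k l : ℚ) (Φ : ℚ → ℚ → ℚ → IPoly3 × Bool) (ax ay az : ℚ) (n m o : ℕ)
    (lo hi : ℚ) : Bool :=
  let g := gridEnclB3 h k l (boxEnclG3 S h k l Φ) ay m az o ax n
  decide (0 < S) && decide (0 < h) && decide (0 < k) && decide (0 < l) && g.2 &&
    decide (lo * S ≤ (g.1.lo : ℚ)) && decide ((g.1.hi : ℚ) ≤ hi * S)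

/-- **Soundness of the generic one-shot certificate**: for every jointly measurable `f` soundly modelled by `Φ`.
[cite: MakinoBerz2003, Algorithm 2] [cite: BerzMakino1999, Sect. 2]
[cite: MahboubiMelquiondSibutpinote2016, Sect. 3.2 Lemma 3] -/
theorem integral_bounds_of_certCheck3G {S : ℕ} {h k l : ℚ} {f : ℝ → ℝ → ℝ → ℝ}
    (hf : Measurable fun z : ℝ × ℝ × ℝ => f z.1 z.2.1 z.2.2) {Φ : ℚ → ℚ → ℚ → IPoly3 × Bool}
    (hΦ : ∀ cx cy cz : ℚ, (Φ cx cy cz).2 = true →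
      TMem3 S h k l (fun u v w => f ((cx : ℝ) + u) ((cy : ℝ) + v) ((cz : ℝ) + w)) (Φ cx cy cz).1)
    {ax ay az : ℚ} {n m o : ℕ} {lo hi : ℚ} (hc : certCheck3G S h k l Φ ax ay az n m o lo hi = true) :
    (lo : ℝ) ≤ ∫ x in (ax : ℝ)..((ax : ℝ) + 2 * n * h), ∫ y in (ay : ℝ)..((ay : ℝ) + 2 * m * k),
        ∫ z in (az : ℝ)..((az : ℝ) + 2 * o * l), f x y z ∧
      ∫ x in (ax : ℝ)..((ax : ℝ) + 2 * n * h), ∫ y in (ay : ℝ)..((ay : ℝ) + 2 * m * k),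
        ∫ z in (az : ℝ)..((az : ℝ) + 2 * o * l), f x y z ≤ (hi : ℝ) := by
  unfold certCheck3G at hc
  simp only [Bool.and_eq_true, decide_eq_true_eq] at hc
  obtain ⟨⟨⟨⟨⟨⟨hS, h0⟩, k0⟩, l0⟩, hok⟩, hlo⟩, hhi⟩ := hc
  exact bounds_of_grid3 hS h0 k0 (boxEnclG3_sound hS h0 k0 l0 hf hΦ) hok hlo hhi

/-! ### Part A′. Box-split certificates (one kernel obligation per box) -/

/-- **The claimed-box rule**: box centre ↦ (the CLAIMED enclosure `Jsss[i][j][p]` of the box it lies in, flag = the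
Taylor-model box `boxEnclG3` accepted AND inside the claim). [cite: MakinoBerz2003, Algorithm 2] -/
def boxClaimG3 (S : ℕ) (h k l : ℚ) (Φ : ℚ → ℚ → ℚ → IPoly3 × Bool) (ax ay az : ℚ)
    (Jsss : List (List (List MI))) (cx cy cz : ℚ) : MI × Bool :=
  let J := ((Jsss.getD (⌊(cx - ax) / (2 * h)⌋.toNat) []).getD (⌊(cy - ay) / (2 * k)⌋.toNat) []).getD
    (⌊(cz - az) / (2 * l)⌋.toNat) ⟨0, 0⟩
  let b := boxEnclG3 S h k l Φ cx cy cz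
  (J, b.2 && decide (J.lo ≤ b.1.lo) && decide (b.1.hi ≤ J.hi))

/-- [folklore] -/
private theorem boxClaimG3_sound {S : ℕ} (hS : 0 < S) {h k l : ℚ} (h0 : 0 < h) (k0 : 0 < k) (l0 : 0 < l)
    {f : ℝ → ℝ → ℝ → ℝ} (hf : Measurable fun z : ℝ × ℝ × ℝ => f z.1 z.2.1 z.2.2)
    {Φ : ℚ → ℚ → ℚ → IPoly3 × Bool}
    (hΦ : ∀ cx cy cz : ℚ, (Φ cx cy cz).2 = true →
      TMem3 S h k l (fun u v w => f ((cx : ℝ) + u) ((cy : ℝ) + v) ((cz : ℝ) + w)) (Φ cx cy cz).1)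
    (ax ay az : ℚ) (Jsss : List (List (List MI))) : BoxSound3 S h k l f (boxClaimG3 S h k l Φ ax ay az Jsss) := by
  intro cx cy cz hok
  simp only [boxClaimG3, Bool.and_eq_true, decide_eq_true_eq] at hok ⊢
  obtain ⟨⟨hb, hlo⟩, hhi⟩ := hok
  obtain ⟨hm, hI, hσ, hτ⟩ := boxEnclG3_sound hS h0 k0 l0 hf hΦ cx cy cz hb
  refine ⟨⟨?_, ?_⟩, hI, hσ, hτ⟩
  · exact le_trans (by exact_mod_cast hlo) hm.1
  · exact le_trans hm.2 (by exact_mod_cast hhi)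

/-- **Kernel obligation for box `(i, j, p)`** (prove each by its own `decide`): the box is accepted and its
Taylor-model enclosure lies inside the claim `Jsss[i][j][p]`. [cite: MakinoBerz2003, Algorithm 2] -/
def boxCheckG3 (S : ℕ) (h k l : ℚ) (Φ : ℚ → ℚ → ℚ → IPoly3 × Bool) (ax ay az : ℚ)
    (Jsss : List (List (List MI))) (i j p : ℕ) : Bool :=
  (boxClaimG3 S h k l Φ ax ay az Jsss (panelCentreFrom h ax i) (panelCentreFrom k ay j)
    (panelCentreFrom l az p)).2

/-- **Final obligation of a box-split certificate**: positivity of `S`, `h`, `k`, `l` and the sum of the claims over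
the `n × m × o` grid inside `[lo·S, hi·S]` (no Taylor model is evaluated). [cite: MakinoBerz2003, Algorithm 2] -/
def sumCheckG3 (S : ℕ) (h k l : ℚ) (Φ : ℚ → ℚ → ℚ → IPoly3 × Bool) (ax ay az : ℚ)
    (Jsss : List (List (List MI))) (n m o : ℕ) (lo hi : ℚ) : Bool :=
  let g := gridEnclB3 h k l (boxClaimG3 S h k l Φ ax ay az Jsss) ay m az o ax n
  decide (0 < S) && decide (0 < h) && decide (0 < k) && decide (0 < l) &&
    decide (lo * S ≤ (g.1.lo : ℚ)) && decide ((g.1.hi : ℚ) ≤ hi * S)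

/-- [folklore] -/
private theorem stackEnclB3_flag (l : ℚ) (β : ℚ → ℚ → ℚ → MI × Bool) (cx cy : ℚ) :
    ∀ (o : ℕ) (a : ℚ), (∀ p : ℕ, p < o → (β cx cy (panelCentreFrom l a p)).2 = true) →
      (stackEnclB3 l β cx cy a o).2 = true
  | 0, _, _ => rfl
  | o + 1, a, H => by
      simp only [stackEnclB3, Bool.and_eq_true]
      exact ⟨H 0 (Nat.succ_pos o), stackEnclB3_flag l β cx cy o (a + 2 * l) fun p hp => H (p + 1) (by omega)⟩

/-- [folklore] -/
private theorem stripEnclB3_flag (k l : ℚ) (β : ℚ → ℚ → ℚ → MI × Bool) (cx az : ℚ) (o : ℕ) :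
    ∀ (m : ℕ) (a : ℚ), (∀ j p : ℕ, j < m → p < o →
        (β cx (panelCentreFrom k a j) (panelCentreFrom l az p)).2 = true) →
      (stripEnclB3 k l β cx az o a m).2 = true
  | 0, _, _ => rfl
  | m + 1, a, H => by
      simp only [stripEnclB3, Bool.and_eq_true]
      exact ⟨stackEnclB3_flag l β cx _ o az fun p hp => H 0 p (Nat.succ_pos m) hp,
        stripEnclB3_flag k l β cx az o m (a + 2 * k) fun j p hj hp => H (j + 1) p (by omega) hp⟩

/-- [folklore] -/
private theorem gridEnclB3_flag (h k l : ℚ) (β : ℚ → ℚ → ℚ → MI × Bool) (ay : ℚ) (m : ℕ) (az : ℚ) (o : ℕ) :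
    ∀ (n : ℕ) (a : ℚ), (∀ i j p : ℕ, i < n → j < m → p < o →
        (β (panelCentreFrom h a i) (panelCentreFrom k ay j) (panelCentreFrom l az p)).2 = true) →
      (gridEnclB3 h k l β ay m az o a n).2 = true
  | 0, _, _ => rfl
  | n + 1, a, H => by
      simp only [gridEnclB3, Bool.and_eq_true]
      exact ⟨stripEnclB3_flag k l β _ az o m ay fun j p hj hp => H 0 j p (Nat.succ_pos n) hj hp,
        gridEnclB3_flag h k l β ay m az o n (a + 2 * h) fun i j p hi hj hp => H (i + 1) j p (by omega) hj hp⟩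

/-- **Soundness of the generic box-split certificate.** [cite: MakinoBerz2003, Algorithm 2]
[cite: MahboubiMelquiondSibutpinote2016, Sect. 3.3] -/
theorem integral_bounds_of_boxCheckG3 {S : ℕ} {h k l : ℚ} {f : ℝ → ℝ → ℝ → ℝ}
    (hf : Measurable fun z : ℝ × ℝ × ℝ => f z.1 z.2.1 z.2.2) {Φ : ℚ → ℚ → ℚ → IPoly3 × Bool}
    (hΦ : ∀ cx cy cz : ℚ, (Φ cx cy cz).2 = true →
      TMem3 S h k l (fun u v w => f ((cx : ℝ) + u) ((cy : ℝ) + v) ((cz : ℝ) + w)) (Φ cx cy cz).1)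
    {ax ay az : ℚ} {Jsss : List (List (List MI))} {n m o : ℕ} {lo hi : ℚ}
    (hbox : ∀ i j p : ℕ, i < n → j < m → p < o → boxCheckG3 S h k l Φ ax ay az Jsss i j p = true)
    (hsum : sumCheckG3 S h k l Φ ax ay az Jsss n m o lo hi = true) :
    (lo : ℝ) ≤ ∫ x in (ax : ℝ)..((ax : ℝ) + 2 * n * h), ∫ y in (ay : ℝ)..((ay : ℝ) + 2 * m * k),
        ∫ z in (az : ℝ)..((az : ℝ) + 2 * o * l), f x y z ∧
      ∫ x in (ax : ℝ)..((ax : ℝ) + 2 * n * h), ∫ y in (ay : ℝ)..((ay : ℝ) + 2 * m * k),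
        ∫ z in (az : ℝ)..((az : ℝ) + 2 * o * l), f x y z ≤ (hi : ℝ) := by
  unfold sumCheckG3 at hsum
  simp only [Bool.and_eq_true, decide_eq_true_eq] at hsum
  obtain ⟨⟨⟨⟨⟨hS, h0⟩, k0⟩, l0⟩, hlo⟩, hhi⟩ := hsum
  have hok := gridEnclB3_flag h k l (boxClaimG3 S h k l Φ ax ay az Jsss) ay m az o n ax hbox
  exact bounds_of_grid3 hS h0 k0 (boxClaimG3_sound hS h0 k0 l0 hf hΦ ax ay az Jsss) hok hlo hhi

/-! ### Part B. The expression language in three variables -/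

/-- Integrand expressions in `x`, `y`, `z`: rational constants, the three variables, `−`, `+`, binary `−`, `·`,
`exp`, `log`, reciprocal and square root (the code list of op. cit. Algorithm 2 over the intrinsics of
Definition 3). [cite: MakinoBerz2003, Algorithm 2] -/
inductive BExpr3 : Type
  /-- the rational constant `q` -/
  | const (q : ℚ) : BExpr3
  /-- the first variable `x` -/
  | varX : BExpr3
  /-- the second variable `y` -/
  | varY : BExpr3
  /-- the third variable `z` -/
  | varZ : BExpr3
  /-- `−A` -/
  | neg (A : BExpr3) : BExpr3
  /-- `A + B` -/
  | add (A B : BExpr3) : BExpr3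
  /-- `A − B` -/
  | sub (A B : BExpr3) : BExpr3
  /-- `A · B` -/
  | mul (A B : BExpr3) : BExpr3
  /-- `e^{A}` -/
  | exp (A : BExpr3) : BExpr3
  /-- `log A` -/
  | log (A : BExpr3) : BExpr3
  /-- `1 / A` -/
  | inv (A : BExpr3) : BExpr3
  /-- `√A` -/
  | sqrt (A : BExpr3) : BExpr3

namespace BExpr3

/-- The real function of three variables denoted by an expression (`log`, `⁻¹`, `√` are Mathlib's total functions).
[cite: MakinoBerz2003, Algorithm 2] -/
noncomputable def toFun₃ : BExpr3 → ℝ → ℝ → ℝ → ℝ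
  | const q => fun _ _ _ => q
  | varX => fun x _ _ => x
  | varY => fun _ y _ => y
  | varZ => fun _ _ z => z
  | neg A => fun x y z => -toFun₃ A x y z
  | add A B => fun x y z => toFun₃ A x y z + toFun₃ B x y z
  | sub A B => fun x y z => toFun₃ A x y z - toFun₃ B x y z
  | mul A B => fun x y z => toFun₃ A x y z * toFun₃ B x y z
  | exp A => fun x y z => Real.exp (toFun₃ A x y z)
  | log A => fun x y z => Real.log (toFun₃ A x y z)
  | inv A => fun x y z => (toFun₃ A x y z)⁻¹
  | sqrt A => fun x y z => Real.sqrt (toFun₃ A x y z)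

/-- Joint (Borel) measurability of the denoted function. [cite: MakinoBerz2003, Algorithm 2] -/
theorem measurable_toFun₃ : ∀ E : BExpr3, Measurable fun z : ℝ × ℝ × ℝ => E.toFun₃ z.1 z.2.1 z.2.2
  | const _ => measurable_const
  | varX => measurable_fst
  | varY => measurable_snd.fst
  | varZ => measurable_snd.snd
  | neg A => (measurable_toFun₃ A).neg
  | add A B => (measurable_toFun₃ A).add (measurable_toFun₃ B)
  | sub A B => (measurable_toFun₃ A).sub (measurable_toFun₃ B)
  | mul A B => (measurable_toFun₃ A).mul (measurable_toFun₃ B)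
  | exp A => Real.measurable_exp.comp (measurable_toFun₃ A)
  | log A => Real.measurable_log.comp (measurable_toFun₃ A)
  | inv A => (measurable_toFun₃ A).inv
  | sqrt A => Real.continuous_sqrt.measurable.comp (measurable_toFun₃ A)

/-- **The box Taylor model of `(u, v, w) ↦ E(cx + u, cy + v, cz + w)` on `|u| ≤ h, |v| ≤ k, |w| ≤ l`** with its
acceptance flag: the identity models, then the code list in trivariate Taylor-model arithmetic with the
intrinsics of `TaylorModelTrivariate.lean` (steps 1–2 of op. cit. Algorithm 2). [cite: MakinoBerz2003, Algorithm 2] -/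
def model (S : ℕ) (h k l : ℚ) (P : EPrm) (cx cy cz : ℚ) : BExpr3 → IPoly3 × Bool
  | const q => (tconst3 (ofRat S q), true)
  | varX => (tvarX3 S (ofRat S cx), true)
  | varY => (tvarY3 S (ofRat S cy), true)
  | varZ => (tvarZ3 S (ofRat S cz), true)
  | neg A =>
      let r := model S h k l P cx cy cz A
      (tneg3 r.1, r.2)
  | add A B =>
      let r := model S h k l P cx cy cz A
      let r' := model S h k l P cx cy cz B
      (tadd3 r.1 r'.1, r.2 && r'.2)
  | sub A B =>
      let r := model S h k l P cx cy cz A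
      let r' := model S h k l P cx cy cz B
      (tsub3 r.1 r'.1, r.2 && r'.2)
  | mul A B =>
      let r := model S h k l P cx cy cz A
      let r' := model S h k l P cx cy cz B
      (tmul3 S h k l P.D r.1 r'.1, r.2 && r'.2)
  | exp A =>
      let r := model S h k l P cx cy cz A
      let t := texp3TM S h k l P.D P.K P.Ke P.ke r.1
      (t.1, r.2 && t.2)
  | log A =>
      let r := model S h k l P cx cy cz A
      let t := tlog3TM S h k l P.D P.K P.Kl r.1
      (t.1, r.2 && t.2)
  | inv A =>
      let r := model S h k l P cx cy cz A
      let t := tinv3TM S h k l P.D P.K r.1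
      (t.1, r.2 && t.2)
  | sqrt A =>
      let r := model S h k l P cx cy cz A
      let t := tsqrt3TM S h k l P.D P.K P.fuel r.1
      (t.1, r.2 && t.2)

/-- **Soundness of `model`**: an accepted box model encloses `(u, v, w) ↦ E(cx + u, cy + v, cz + w)` on the box.
[cite: MakinoBerz2003, Algorithm 2] -/
theorem tmem3_model {S : ℕ} (hS : 0 < S) {h k l : ℚ} (h0 : 0 ≤ h) (k0 : 0 ≤ k) (l0 : 0 ≤ l) (P : EPrm)
    (cx cy cz : ℚ) : ∀ E : BExpr3, (model S h k l P cx cy cz E).2 = true →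
      TMem3 S h k l (fun u v w => E.toFun₃ ((cx : ℝ) + u) ((cy : ℝ) + v) ((cz : ℝ) + w))
        (model S h k l P cx cy cz E).1
  | const q, _ => by
      simpa [model, toFun₃] using tmem3_const (h := h) (k := k) (l := l) (mem_ofRat S q)
  | varX, _ => by
      simpa [model, toFun₃] using tmem3_varX (S := S) (h := h) (k := k) (l := l) (mem_ofRat S cx)
  | varY, _ => by
      simpa [model, toFun₃] using tmem3_varY (S := S) (h := h) (k := k) (l := l) (mem_ofRat S cy)
  | varZ, _ => by
      simpa [model, toFun₃] using tmem3_varZ (S := S) (h := h) (k := k) (l := l) (mem_ofRat S cz)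
  | neg A, hok => by
      simp only [model] at hok ⊢
      exact tmem3_neg (tmem3_model hS h0 k0 l0 P cx cy cz A hok)
  | add A B, hok => by
      simp only [model, Bool.and_eq_true] at hok ⊢
      exact tmem3_add (tmem3_model hS h0 k0 l0 P cx cy cz A hok.1) (tmem3_model hS h0 k0 l0 P cx cy cz B hok.2)
  | sub A B, hok => by
      simp only [model, Bool.and_eq_true] at hok ⊢
      exact tmem3_sub (tmem3_model hS h0 k0 l0 P cx cy cz A hok.1) (tmem3_model hS h0 k0 l0 P cx cy cz B hok.2)
  | mul A B, hok => by
      simp only [model, Bool.and_eq_true] at hok ⊢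
      exact tmem3_mul hS h0 k0 l0 P.D (tmem3_model hS h0 k0 l0 P cx cy cz A hok.1)
        (tmem3_model hS h0 k0 l0 P cx cy cz B hok.2)
  | exp A, hok => by
      simp only [model, Bool.and_eq_true] at hok ⊢
      exact tmem3_exp_of_texp3TM hS h0 k0 l0 (tmem3_model hS h0 k0 l0 P cx cy cz A hok.1) hok.2
  | log A, hok => by
      simp only [model, Bool.and_eq_true] at hok ⊢
      exact tmem3_log_of_tlog3TM hS h0 k0 l0 (tmem3_model hS h0 k0 l0 P cx cy cz A hok.1) hok.2
  | inv A, hok => by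
      simp only [model, Bool.and_eq_true] at hok ⊢
      exact tmem3_inv_of_tinv3TM hS h0 k0 l0 (tmem3_model hS h0 k0 l0 P cx cy cz A hok.1) hok.2
  | sqrt A, hok => by
      simp only [model, Bool.and_eq_true] at hok ⊢
      exact tmem3_sqrt_of_tsqrt3TM hS h0 k0 l0 (tmem3_model hS h0 k0 l0 P cx cy cz A hok.1) hok.2

end BExpr3

/-- **The certificate for `BExpr3` integrands over a box** (`= certCheck3G` on the box modeller `BExpr3.model`).
[cite: MakinoBerz2003, Algorithm 2] -/
def certCheck3E (S : ℕ) (h k l : ℚ) (P : EPrm) (E : BExpr3) (ax ay az : ℚ) (n m o : ℕ) (lo hi : ℚ) : Bool :=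
  certCheck3G S h k l (fun cx cy cz => BExpr3.model S h k l P cx cy cz E) ax ay az n m o lo hi

/-- **Soundness** (no side hypotheses):
`certCheck3E … = true → lo ≤ ∫_{ax}^{ax+2nh} ∫_{ay}^{ay+2mk} ∫_{az}^{az+2ol} E ≤ hi`. [cite: MakinoBerz2003, Algorithm 2]
[cite: BerzMakino1999, Sect. 2] [cite: MahboubiMelquiondSibutpinote2016, Sect. 3.2 Lemma 3] -/
theorem integral_bounds_of_certCheck3E {S : ℕ} {h k l : ℚ} {P : EPrm} {E : BExpr3} {ax ay az : ℚ}
    {n m o : ℕ} {lo hi : ℚ} (hc : certCheck3E S h k l P E ax ay az n m o lo hi = true) :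
    (lo : ℝ) ≤ ∫ x in (ax : ℝ)..((ax : ℝ) + 2 * n * h), ∫ y in (ay : ℝ)..((ay : ℝ) + 2 * m * k),
        ∫ z in (az : ℝ)..((az : ℝ) + 2 * o * l), E.toFun₃ x y z ∧
      ∫ x in (ax : ℝ)..((ax : ℝ) + 2 * n * h), ∫ y in (ay : ℝ)..((ay : ℝ) + 2 * m * k),
        ∫ z in (az : ℝ)..((az : ℝ) + 2 * o * l), E.toFun₃ x y z ≤ (hi : ℝ) := by
  have hpos : 0 < S ∧ 0 < h ∧ 0 < k ∧ 0 < l := by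
    unfold certCheck3E certCheck3G at hc
    simp only [Bool.and_eq_true, decide_eq_true_eq] at hc
    exact ⟨hc.1.1.1.1.1.1, hc.1.1.1.1.1.2, hc.1.1.1.1.2, hc.1.1.1.2⟩
  exact integral_bounds_of_certCheck3G (BExpr3.measurable_toFun₃ E)
    (fun cx cy cz hok => BExpr3.tmem3_model hpos.1 hpos.2.1.le hpos.2.2.1.le hpos.2.2.2.le P cx cy cz E hok) hc

/-- **Box-split certificate for `BExpr3` integrands, kernel obligation for box `(i, j, p)`.**
[cite: MakinoBerz2003, Algorithm 2] -/
def boxCheck3E (S : ℕ) (h k l : ℚ) (P : EPrm) (E : BExpr3) (ax ay az : ℚ) (Jsss : List (List (List MI)))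
    (i j p : ℕ) : Bool :=
  boxCheckG3 S h k l (fun cx cy cz => BExpr3.model S h k l P cx cy cz E) ax ay az Jsss i j p

/-- **Box-split certificate for `BExpr3` integrands, final obligation.** [cite: MakinoBerz2003, Algorithm 2] -/
def sumCheck3E (S : ℕ) (h k l : ℚ) (P : EPrm) (E : BExpr3) (ax ay az : ℚ) (Jsss : List (List (List MI)))
    (n m o : ℕ) (lo hi : ℚ) : Bool :=
  sumCheckG3 S h k l (fun cx cy cz => BExpr3.model S h k l P cx cy cz E) ax ay az Jsss n m o lo hi

/-- **Soundness of the box-split certificate** (no side hypotheses). [cite: MakinoBerz2003, Algorithm 2]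
[cite: MahboubiMelquiondSibutpinote2016, Sect. 3.3] -/
theorem integral_bounds_of_boxCheck3E {S : ℕ} {h k l : ℚ} {P : EPrm} {E : BExpr3} {ax ay az : ℚ}
    {Jsss : List (List (List MI))} {n m o : ℕ} {lo hi : ℚ}
    (hbox : ∀ i j p : ℕ, i < n → j < m → p < o → boxCheck3E S h k l P E ax ay az Jsss i j p = true)
    (hsum : sumCheck3E S h k l P E ax ay az Jsss n m o lo hi = true) :
    (lo : ℝ) ≤ ∫ x in (ax : ℝ)..((ax : ℝ) + 2 * n * h), ∫ y in (ay : ℝ)..((ay : ℝ) + 2 * m * k),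
        ∫ z in (az : ℝ)..((az : ℝ) + 2 * o * l), E.toFun₃ x y z ∧
      ∫ x in (ax : ℝ)..((ax : ℝ) + 2 * n * h), ∫ y in (ay : ℝ)..((ay : ℝ) + 2 * m * k),
        ∫ z in (az : ℝ)..((az : ℝ) + 2 * o * l), E.toFun₃ x y z ≤ (hi : ℝ) := by
  have hpos : 0 < S ∧ 0 < h ∧ 0 < k ∧ 0 < l := by
    unfold sumCheck3E sumCheckG3 at hsum
    simp only [Bool.and_eq_true, decide_eq_true_eq] at hsum
    exact ⟨hsum.1.1.1.1.1, hsum.1.1.1.1.2, hsum.1.1.1.2, hsum.1.1.2⟩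
  exact integral_bounds_of_boxCheckG3 (BExpr3.measurable_toFun₃ E)
    (fun cx cy cz hok => BExpr3.tmem3_model hpos.1 hpos.2.1.le hpos.2.2.1.le hpos.2.2.2.le P cx cy cz E hok)
    hbox hsum

end PolyMP

end Literature.Analysis.ValidatedNumerics
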